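import Summits.CriticalPhenomena.PercolationContinuityZ3.Theorems.PercNearOneGluingNoHeavyLowerTailCombRowsLeFive
import Summits.CriticalPhenomena.PercolationContinuityZ3.Theorems.PercNearOneGluingNoHeavyLowerTailTerminalEdgeStepLeFive

/-!
# `NoHeavyLowerTail` (crux stmt-CriticalPhenomena-4575): the six HYBRID Richards–Sahi rows of the SHK3⁺ polarization and the surviving split N3 hold on every
# weighted graph with at most five vertices, for ALL edge weights (kernel-checked, three-copy comb positive) — first use of the generic `CombRows` packaging

Support file (prover seat `prim-bnk-1`; `--supports stmt-CriticalPhenomena-4575`; COMPUTATIONAL: fourteen `checkC` evaluations use `native_decide`).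

With the notation of `…TerminalEdgeStepLeFive` (marked `a,b,c,y`; `D_uv = {u↮v}`, `G_ab = {b↮a, b↮y}`, `G_ac = {c↮a, c↮y}`, `G_bc = {b↮c} ∖ ({a↔b,c↔y} ∪ {a↔c,b↔y})`;
`E₃ = sahiE3 μ`), the terminal-edge polarization identities involve the six hybrid rows (ttrl2 bern4/README "POLARIZATION L1/L2")
  `E1 = E₃(D_bc,D_ac,G_ab)`, `E2 = E₃(D_bc,G_ac,D_ab)`, `E3g = E₃(D_bc,G_ac,G_ab)`, `E4 = E₃(G_bc,D_ac,D_ab)`, `E5 = E₃(G_bc,D_ac,G_ab)`, `E6 = E₃(G_bc,G_ac,D_ab)`,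
each an instance of Sahi's `C₃` for decreasing events (one slot read in the contracted graph `G/ay`), and the split `N3 = E1 − μ(a|bcy)·μ(a|b|cy)` (the only surviving
"near-miss" split of (L1); `N1`, `N2` are census-false and indeed have negative three-copy fibres already on `K₄`).  All seven: 0 violations on 3.13·10⁶ exact instances
`n ≤ 7` and 26.5 M composed laws (ttrl2 line 400), no certificate known.

**Theorems `hybridRow_le_five (i : Fin 7)`** (term form) and `e1_le_five … e6_le_five`, `n3_le_five` (`sahiE3` form): each row holds for every `n ≤ 5`, every `w`, all pairwise
distinct `a b c y : Fin n`.  PROOF = `CombRows.quad_cval_le_five`: the `e3Terms` family is relabelling-equivariant (`rfl`) and passes `checkC` at the standard quadruple of `K₄`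
(`2^23`) and `K₅` (`2^35`) — Richards-comb positive there (K₅ zero/positive fibre counts: E1,E2 838 558/210 018; E3g 911 616/136 960; E4 802 893/245 683; E5,E6 832 395/216 181;
N3 839 154/209 422; 0 negative; two exact C implementations, run/shared/lean/prim/prim-l12/prim-bnk-1/).  Nothing is claimed beyond five vertices.
-/

namespace Summit.CriticalPhenomena.PercolationContinuityZ3.Theorems.HybridRows

open Finset MeasureTheory OneCutCert CovTransferCert E3GroupSepCert TerminalEdgeStep CombRows
open scoped BigOperators
open Literature.Probability.Percolation Literature.Probability.LatticeModels

/-- The term families: `0..5 = E1..E6` (order E1, E2, E3g, E4, E5, E6), `6 = N3`, at the quadruple `(a,b,c,y)`. [this work] -/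
def hybTerms (i : Fin 7) (n : ℕ) (x : Quad n) : List (CTerm n) :=
  let a := x.1
  let b := x.2.1
  let c := x.2.2.1
  let y := x.2.2.2
  match i with
  | 0 => e3Terms (TerminalEdgeStep.pD b c) (TerminalEdgeStep.pD a c) (pG a b y)
  | 1 => e3Terms (TerminalEdgeStep.pD b c) (pG a c y) (TerminalEdgeStep.pD a b)
  | 2 => e3Terms (TerminalEdgeStep.pD b c) (pG a c y) (pG a b y)
  | 3 => e3Terms (pGbc a b c y) (TerminalEdgeStep.pD a c) (TerminalEdgeStep.pD a b)
  | 4 => e3Terms (pGbc a b c y) (TerminalEdgeStep.pD a c) (pG a b y)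
  | 5 => e3Terms (pGbc a b c y) (pG a c y) (TerminalEdgeStep.pD a b)
  | 6 => e3Terms (TerminalEdgeStep.pD b c) (TerminalEdgeStep.pD a c) (pG a b y) ++ [(-1, pTrue, pB₃ a b c y, pA₂ a b c y)]

/-- Each family commutes with vertex relabellings. [this work] -/
theorem hybTerms_equivariant (i : Fin 7) : QuadEquivariant (hybTerms i) := by
  intro n τ x
  obtain ⟨a, b, c, y⟩ := x
  fin_cases i <;> rfl

/-- `K₄` checks (base `2^23`). [this work] -/
theorem checkHyb4 (i : Fin 7) : checkC 4 23 (hybTerms i 4 (quad₀ 4 le_rfl)) = true := by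
  fin_cases i <;> native_decide
/-- `K₅` checks (base `2^35`). [this work] -/
theorem checkHyb5 (i : Fin 7) : checkC 5 35 (hybTerms i 5 (quad₀ 5 (by norm_num))) = true := by
  fin_cases i <;> native_decide

/-- **The seven rows (term form) on every weighted graph with at most five vertices.** [this work] -/
theorem hybridRow_le_five (i : Fin 7) : ∀ n ≤ 5, ∀ (w : Sym2 (Fin n) → unitInterval) (a b c y : Fin n),
    a ≠ b → a ≠ c → a ≠ y → b ≠ c → b ≠ y → c ≠ y → 0 ≤ cval w (hybTerms i n (a, b, c, y)) :=
  quad_cval_le_five (hybTerms_equivariant i) (checkHyb4 i) (checkHyb5 i)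

variable {n : ℕ}

/-- Unfolding an `e3Terms` value into `sahiE3`. [this work] -/
theorem cval_e3Terms (w : Sym2 (Fin n) → unitInterval) (A B C : CRel n → Bool) :
    cval w (e3Terms A B C) = sahiE3 (prodBernoulli w) (connEvent A) (connEvent B) (connEvent C) := by
  unfold cval e3Terms
  simp only [List.map_cons, List.map_nil, List.sum_cons, List.sum_nil, pr_pTrue]
  unfold pr
  simp only [connEvent_pAnd]
  rw [sahiE3_def, ← Set.inter_assoc]
  push_cast
  ring

/-- **E1 on ≤ 5 vertices**: `E₃(D_bc, D_ac, G_ab) ≥ 0`. [this work] -/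
theorem e1_le_five (hn : n ≤ 5) (w : Sym2 (Fin n) → unitInterval) (a b c y : Fin n) (hab : a ≠ b) (hac : a ≠ c) (hay : a ≠ y) (hbc : b ≠ c)
    (hby : b ≠ y) (hcy : c ≠ y) :
    0 ≤ sahiE3 (prodBernoulli w) (openConn b c)ᶜ (openConn a c)ᶜ ((openConn a b)ᶜ ∩ (openConn y b)ᶜ) := by
  have h := hybridRow_le_five 0 n hn w a b c y hab hac hay hbc hby hcy
  unfold hybTerms at h
  rwa [cval_e3Terms, TerminalEdgeStep.connEvent_pD, TerminalEdgeStep.connEvent_pD, connEvent_pG] at h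

/-- **E2 on ≤ 5 vertices**: `E₃(D_bc, G_ac, D_ab) ≥ 0`. [this work] -/
theorem e2_le_five (hn : n ≤ 5) (w : Sym2 (Fin n) → unitInterval) (a b c y : Fin n) (hab : a ≠ b) (hac : a ≠ c) (hay : a ≠ y) (hbc : b ≠ c)
    (hby : b ≠ y) (hcy : c ≠ y) :
    0 ≤ sahiE3 (prodBernoulli w) (openConn b c)ᶜ ((openConn a c)ᶜ ∩ (openConn y c)ᶜ) (openConn a b)ᶜ := by
  have h := hybridRow_le_five 1 n hn w a b c y hab hac hay hbc hby hcy
  unfold hybTerms at h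
  rwa [cval_e3Terms, TerminalEdgeStep.connEvent_pD, TerminalEdgeStep.connEvent_pD, connEvent_pG] at h

/-- **E3g on ≤ 5 vertices**: `E₃(D_bc, G_ac, G_ab) ≥ 0`. [this work] -/
theorem e3g_le_five (hn : n ≤ 5) (w : Sym2 (Fin n) → unitInterval) (a b c y : Fin n) (hab : a ≠ b) (hac : a ≠ c) (hay : a ≠ y) (hbc : b ≠ c)
    (hby : b ≠ y) (hcy : c ≠ y) :
    0 ≤ sahiE3 (prodBernoulli w) (openConn b c)ᶜ ((openConn a c)ᶜ ∩ (openConn y c)ᶜ) ((openConn a b)ᶜ ∩ (openConn y b)ᶜ) := by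
  have h := hybridRow_le_five 2 n hn w a b c y hab hac hay hbc hby hcy
  unfold hybTerms at h
  rwa [cval_e3Terms, TerminalEdgeStep.connEvent_pD, connEvent_pG, connEvent_pG] at h

/-- **E4 on ≤ 5 vertices**: `E₃(G_bc, D_ac, D_ab) ≥ 0`. [this work] -/
theorem e4_le_five (hn : n ≤ 5) (w : Sym2 (Fin n) → unitInterval) (a b c y : Fin n) (hab : a ≠ b) (hac : a ≠ c) (hay : a ≠ y) (hbc : b ≠ c)
    (hby : b ≠ y) (hcy : c ≠ y) :
    0 ≤ sahiE3 (prodBernoulli w) ((openConn b c)ᶜ ∩ (openConn a b ∩ openConn c y ∪ openConn a c ∩ openConn b y)ᶜ) (openConn a c)ᶜ (openConn a b)ᶜ := by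
  have h := hybridRow_le_five 3 n hn w a b c y hab hac hay hbc hby hcy
  unfold hybTerms at h
  rwa [cval_e3Terms, connEvent_pGbc, TerminalEdgeStep.connEvent_pD, TerminalEdgeStep.connEvent_pD] at h

/-- **E5 on ≤ 5 vertices**: `E₃(G_bc, D_ac, G_ab) ≥ 0`. [this work] -/
theorem e5_le_five (hn : n ≤ 5) (w : Sym2 (Fin n) → unitInterval) (a b c y : Fin n) (hab : a ≠ b) (hac : a ≠ c) (hay : a ≠ y) (hbc : b ≠ c)
    (hby : b ≠ y) (hcy : c ≠ y) :
    0 ≤ sahiE3 (prodBernoulli w) ((openConn b c)ᶜ ∩ (openConn a b ∩ openConn c y ∪ openConn a c ∩ openConn b y)ᶜ) (openConn a c)ᶜ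
      ((openConn a b)ᶜ ∩ (openConn y b)ᶜ) := by
  have h := hybridRow_le_five 4 n hn w a b c y hab hac hay hbc hby hcy
  unfold hybTerms at h
  rwa [cval_e3Terms, connEvent_pGbc, TerminalEdgeStep.connEvent_pD, connEvent_pG] at h

/-- **E6 on ≤ 5 vertices**: `E₃(G_bc, G_ac, D_ab) ≥ 0`. [this work] -/
theorem e6_le_five (hn : n ≤ 5) (w : Sym2 (Fin n) → unitInterval) (a b c y : Fin n) (hab : a ≠ b) (hac : a ≠ c) (hay : a ≠ y) (hbc : b ≠ c)
    (hby : b ≠ y) (hcy : c ≠ y) :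
    0 ≤ sahiE3 (prodBernoulli w) ((openConn b c)ᶜ ∩ (openConn a b ∩ openConn c y ∪ openConn a c ∩ openConn b y)ᶜ) ((openConn a c)ᶜ ∩ (openConn y c)ᶜ)
      (openConn a b)ᶜ := by
  have h := hybridRow_le_five 5 n hn w a b c y hab hac hay hbc hby hcy
  unfold hybTerms at h
  rwa [cval_e3Terms, connEvent_pGbc, connEvent_pG, TerminalEdgeStep.connEvent_pD] at h

/-- **N3 on ≤ 5 vertices**: `E₃(D_bc, D_ac, G_ab) ≥ μ(a|bcy)·μ(a|b|cy)` (the surviving split of (L1)). [this work] -/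
theorem n3_le_five (hn : n ≤ 5) (w : Sym2 (Fin n) → unitInterval) (a b c y : Fin n) (hab : a ≠ b) (hac : a ≠ c) (hay : a ≠ y) (hbc : b ≠ c)
    (hby : b ≠ y) (hcy : c ≠ y) :
    (prodBernoulli w).real (openConn b c ∩ (openConn a b)ᶜ ∩ openConn b y) *
        (prodBernoulli w).real ((openConn a b)ᶜ ∩ (openConn a c)ᶜ ∩ (openConn b c)ᶜ ∩ openConn y c) ≤
      sahiE3 (prodBernoulli w) (openConn b c)ᶜ (openConn a c)ᶜ ((openConn a b)ᶜ ∩ (openConn y b)ᶜ) := by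
  have h := hybridRow_le_five 6 n hn w a b c y hab hac hay hbc hby hcy
  unfold hybTerms at h
  rw [cval, List.map_append, List.sum_append, ← cval, cval_e3Terms, TerminalEdgeStep.connEvent_pD, TerminalEdgeStep.connEvent_pD, connEvent_pG] at h
  simp only [List.map_cons, List.map_nil, List.sum_cons, List.sum_nil, pr_pTrue] at h
  unfold pr at h
  rw [connEvent_pB₃, connEvent_pA₂] at h
  push_cast at h
  linarith

end Summit.CriticalPhenomena.PercolationContinuityZ3.Theorems.HybridRows
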